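import Summits.AtomisticToContinuum.HydrodynamicLimit.Theorems.MourreKoopmanChargesStressStrongMixingTorusStatics
import Summits.AtomisticToContinuum.HydrodynamicLimit.Theorems.AntiMazurCoboundariesShearStressHalfDrudeMarginal
import HarnessLib

/-!
# `StressStrongMixing` · line `birth`: exact finite-`N` symmetries of the torus two-time stress moment
# (translation invariance in the test functions, swap symmetry)

Support file for the crux item stmt-AtomisticToContinuum-9584 (`StressStrongMixing`, route `MourreKoopmanCharges` of
`AtomisticToContinuum/HydrodynamicLimit`), line `birth` (`Cruxes/StressStrongMixing/Lines/birth.lean`), stub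
`stub_torusStressIdentificationTrig` (identification of the torus two-time stress moments on real Fourier monomials).
The crux's torus quantity is
`M_N(s; χ₁, χ₂) := (N+1)·E_{G_N}[Π(χ₁)(Φ_{s(N+1)^{-1/3}} z)·Π(χ₂)(z)]`, `Π(χ)(z) = (N+1)⁻¹ Σᵢ χ(xᵢ) vᵢ⁰vᵢ¹`,
under the canonical Gibbs law at rest `G_N = localGibbsLaw σ 1 0 θ N (Φ N)` of `N + 1` hard spheres of diameter
`σ(N+1)^{-1/3}` on the unit torus `𝕋³`.  Two EXACT finite-`N` symmetries of `M_N` are proved here, for every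
`σ, θ, N, s` and every flow family (no smallness, no probability-measure hypothesis):

* **translation invariance in the test functions** (`torusStressMoment_posShift`, NO hypothesis on `χ₁, χ₂`):
  `M_N(s; χ₁(· + a), χ₂(· + a)) = M_N(s; χ₁, χ₂)` for every `a ∈ 𝕋³` — the homogeneous Gibbs law is invariant under
  the diagonal translation `T_a` of all positions (`ShearStressHalfDrudeMarginal.integral_comp_posShift_localGibbsLaw_const`),
  every torus hard-sphere flow commutes with `T_a` almost everywhere (`HardSphereFlow.flow_posShift_ae`, in its `G_N`-a.e.
  form `ShearStressHalfDrudeMarginal.flow_posShift_ae_localGibbsLaw`), and `Π(χ)(T_a z) = Π(χ(· + a))(z)`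
  (`stressField_posShift`).  This is the symmetry that kills the moments at non-resonant pairs of macroscopic
  wavenumbers (`n ≠ ±m`) and makes the `2 × 2` block at `n = m` scalar-plus-antisymmetric;
* **swap symmetry** (`torusStressMoment_swap`, `χ₁, χ₂` continuous): `M_N(s; χ₁, χ₂) = M_N(s; χ₂, χ₁)` — stationarity of
  `G_N` under the flow (`measurePreserving_flow_localGibbsLaw_const`) turns `E[X(Φ_t z)Y(z)]` into `E[X(z)Y(Φ_{-t} z)]`,
  and the velocity reversal `S = flipVel` (`G_N` is `S`-invariant, `measurePreserving_flipVel_localGibbsLaw`;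
  `Φ_{-t} S = S Φ_t` a.e., `ae_flow_flipVel_localGibbsLaw`; the stress `v⁰v¹` is even, `stressField_flipVel`) turns
  `Φ_{-t}` back into `Φ_t`.  With the previous item the antisymmetric part of the `n = m` block vanishes too.

References: H. Spohn, *Large Scale Dynamics of Interacting Particles* (1991), Part I §2.3, §7.1; I. Gallagher,
L. Saint-Raymond, B. Texier, *From Newton to Boltzmann* (2013), §1.1, §4.2 (homogeneity and reversibility of the
hard-sphere dynamics).
-/

noncomputable section

open MeasureTheory ProbabilityTheory Filter Topology
open scoped InnerProductSpace ENNReal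

namespace Summit.AtomisticToContinuum.HydrodynamicLimit.Theorems.MourreKoopmanChargesStressStrongMixing

open Literature.MathematicalPhysics.KineticTheory Literature.Analysis.FluidPDE

/-! ### The empirical stress field under translation and velocity reversal -/

/-- **Translating all positions translates the test function**: `Π(χ)(T_a z) = Π(χ(· + a))(z)` for the empirical
shear-stress field `Π(χ)(z) = ∫ χ(y.1)(y.2 0 · y.2 1) d(empiricalMeasure z) = n⁻¹ Σᵢ χ(xᵢ) vᵢ⁰vᵢ¹`. [folklore] -/
theorem stressField_posShift {n : ℕ} (χ : T3 → ℝ) (a : T3) (z : Config n (Fin 3) T3) :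
    ∫ y, χ y.1 * (y.2 0 * y.2 1)
        ∂(empiricalMeasure (fun i => ((z i).1 + a, (z i).2) : Config n (Fin 3) T3)) =
      ∫ y, χ (y.1 + a) * (y.2 0 * y.2 1) ∂(empiricalMeasure z) := by
  rw [integral_empiricalMeasure, integral_empiricalMeasure]

/-- **The empirical stress field is even under velocity reversal**: `Π(χ)(flipVel z) = Π(χ)(z)`
(`(-v⁰)(-v¹) = v⁰v¹`). [folklore] -/
theorem stressField_flipVel {n : ℕ} (χ : T3 → ℝ) (z : Config n (Fin 3) T3) :
    ∫ y, χ y.1 * (y.2 0 * y.2 1) ∂(empiricalMeasure (flipVel z)) =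
      ∫ y, χ y.1 * (y.2 0 * y.2 1) ∂(empiricalMeasure z) := by
  rw [integral_empiricalMeasure, integral_empiricalMeasure]
  simp only [flipVel_apply, PiLp.neg_apply, neg_mul_neg]

/-! ### Translation invariance of the torus two-time stress moment -/

/-- **Translation invariance of the crux's torus moment in the test functions** (exact, every `N`; no hypothesis on
`σ, θ, χ₁, χ₂, s`): for every `a ∈ 𝕋³`,
`(N+1)·E_{G_N}[Π(χ₁(·+a))(Φ_t z)·Π(χ₂(·+a))(z)] = (N+1)·E_{G_N}[Π(χ₁)(Φ_t z)·Π(χ₂)(z)]`, `t = s(N+1)^{-1/3}`.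
Proof: `E_{G_N}[f(T_a z)] = E_{G_N}[f(z)]` (translation invariance of the homogeneous Gibbs law, the translation being a
measurable equivalence), `Φ_t (T_a z) = T_a (Φ_t z)` for `G_N`-a.e. `z`, and `Π(χ)(T_a w) = Π(χ(·+a))(w)`. [folklore] -/
theorem torusStressMoment_posShift :
    ∀ (σ θ : ℝ) (Φ : (N : ℕ) → HardSphereFlow (Torus.geometry (Fin 3)) (hsDiameter σ N) (N + 1))
      (χ₁ χ₂ : T3 → ℝ) (s : ℝ) (N : ℕ) (a : T3),
    ((N : ℝ) + 1) * ∫ z, (∫ y, χ₁ (y.1 + a) * (y.2 0 * y.2 1)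
        ∂(empiricalMeasure ((Φ N).flow (s * ((N : ℝ) + 1) ^ (-(1 / 3 : ℝ))) z))) *
      (∫ y, χ₂ (y.1 + a) * (y.2 0 * y.2 1) ∂(empiricalMeasure z))
      ∂(localGibbsLaw σ (fun _ => 1) (fun _ => 0) (fun _ => θ) N (Φ N)) =
    ((N : ℝ) + 1) * ∫ z, (∫ y, χ₁ y.1 * (y.2 0 * y.2 1)
        ∂(empiricalMeasure ((Φ N).flow (s * ((N : ℝ) + 1) ^ (-(1 / 3 : ℝ))) z))) *
      (∫ y, χ₂ y.1 * (y.2 0 * y.2 1) ∂(empiricalMeasure z))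
      ∂(localGibbsLaw σ (fun _ => 1) (fun _ => 0) (fun _ => θ) N (Φ N)) := by
  intro σ θ Φ χ₁ χ₂ s N a
  congr 1
  set t : ℝ := s * ((N : ℝ) + 1) ^ (-(1 / 3 : ℝ)) with ht
  have h := ShearStressHalfDrudeMarginal.integral_comp_posShift_localGibbsLaw_const σ 1 θ 0 N (Φ N) a
    (fun z => (∫ y, χ₁ y.1 * (y.2 0 * y.2 1) ∂(empiricalMeasure ((Φ N).flow t z))) *
      (∫ y, χ₂ y.1 * (y.2 0 * y.2 1) ∂(empiricalMeasure z)))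
  simp only at h
  rw [← h]
  refine integral_congr_ae ?_
  filter_upwards [ShearStressHalfDrudeMarginal.flow_posShift_ae_localGibbsLaw σ (fun _ => 1) (fun _ => θ)
    (fun _ => 0) N (Φ N) a t] with z hz
  rw [hz, stressField_posShift χ₁ a, stressField_posShift χ₂ a]

/-! ### Swap symmetry of the torus two-time stress moment -/

/-- **Swap symmetry of the crux's torus moment** (exact, every `N`; `χ₁, χ₂` continuous, no hypothesis on `σ, θ, s`):
`(N+1)·E_{G_N}[Π(χ₁)(Φ_t z)·Π(χ₂)(z)] = (N+1)·E_{G_N}[Π(χ₂)(Φ_t z)·Π(χ₁)(z)]`.  Proof: substitute `z ↦ S z`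
(`S = flipVel` preserves `G_N` and is a measurable embedding), use `Φ_t S = S Φ_{-t}` `G_N`-a.e. and the evenness
`Π(χ) ∘ S = Π(χ)`, then substitute `z ↦ Φ_t w` (`G_N` is `Φ_t`-invariant; the integrand is measurable for continuous
test functions) and `Φ_{-t} Φ_t w = w` on the good set, which carries `G_N`. [folklore] -/
theorem torusStressMoment_swap (σ θ : ℝ)
    (Φ : (N : ℕ) → HardSphereFlow (Torus.geometry (Fin 3)) (hsDiameter σ N) (N + 1))
    {χ₁ χ₂ : T3 → ℝ} (hχ₁ : Continuous χ₁) (hχ₂ : Continuous χ₂) (s : ℝ) (N : ℕ) :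
    ((N : ℝ) + 1) * ∫ z, (∫ y, χ₁ y.1 * (y.2 0 * y.2 1)
        ∂(empiricalMeasure ((Φ N).flow (s * ((N : ℝ) + 1) ^ (-(1 / 3 : ℝ))) z))) *
      (∫ y, χ₂ y.1 * (y.2 0 * y.2 1) ∂(empiricalMeasure z))
      ∂(localGibbsLaw σ (fun _ => 1) (fun _ => 0) (fun _ => θ) N (Φ N)) =
    ((N : ℝ) + 1) * ∫ z, (∫ y, χ₂ y.1 * (y.2 0 * y.2 1)
        ∂(empiricalMeasure ((Φ N).flow (s * ((N : ℝ) + 1) ^ (-(1 / 3 : ℝ))) z))) *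
      (∫ y, χ₁ y.1 * (y.2 0 * y.2 1) ∂(empiricalMeasure z))
      ∂(localGibbsLaw σ (fun _ => 1) (fun _ => 0) (fun _ => θ) N (Φ N)) := by
  congr 1
  set t : ℝ := s * ((N : ℝ) + 1) ^ (-(1 / 3 : ℝ)) with ht
  set Ψ := Φ N with hΨ
  set G := localGibbsLaw σ (fun _ => 1) (fun _ => 0) (fun _ => θ) N Ψ with hG
  have hSe := measurableEmbedding_flipVel (X := T3) (d := Fin 3) (N := N + 1)
  have hS := measurePreserving_flipVel_localGibbsLaw σ (fun _ => 1) (fun _ => θ) N Ψ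
  have hrev := ae_flow_flipVel_localGibbsLaw σ (fun _ => 1) (fun _ => (0 : V3)) (fun _ => θ) N Ψ t
  have hgood := ae_mem_good_localGibbsLaw σ (fun _ => 1) (fun _ => (0 : V3)) (fun _ => θ) N Ψ
  -- the integrand `X(Φ_{-t} z) · Y(z)` is measurable
  have hmeas : AEStronglyMeasurable (fun z : Config (N + 1) (Fin 3) T3 =>
      (∫ y, χ₁ y.1 * (y.2 0 * y.2 1) ∂(empiricalMeasure (Ψ.flow (-t) z))) *
        (∫ y, χ₂ y.1 * (y.2 0 * y.2 1) ∂(empiricalMeasure z))) G :=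
    (((measurable_stressField (n := N + 1) hχ₁).comp (Ψ.measurable_flow (-t))).mul
      (measurable_stressField (n := N + 1) hχ₂)).aestronglyMeasurable
  calc ∫ z, (∫ y, χ₁ y.1 * (y.2 0 * y.2 1) ∂(empiricalMeasure (Ψ.flow t z))) *
        (∫ y, χ₂ y.1 * (y.2 0 * y.2 1) ∂(empiricalMeasure z)) ∂G
      = ∫ z, (∫ y, χ₁ y.1 * (y.2 0 * y.2 1) ∂(empiricalMeasure (Ψ.flow t (flipVel z)))) *
          (∫ y, χ₂ y.1 * (y.2 0 * y.2 1) ∂(empiricalMeasure (flipVel z))) ∂G :=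
        (hS.integral_comp hSe (fun z : Config (N + 1) (Fin 3) T3 =>
          (∫ y, χ₁ y.1 * (y.2 0 * y.2 1) ∂(empiricalMeasure (Ψ.flow t z))) *
            (∫ y, χ₂ y.1 * (y.2 0 * y.2 1) ∂(empiricalMeasure z)))).symm
    _ = ∫ z, (∫ y, χ₁ y.1 * (y.2 0 * y.2 1) ∂(empiricalMeasure (Ψ.flow (-t) z))) *
          (∫ y, χ₂ y.1 * (y.2 0 * y.2 1) ∂(empiricalMeasure z)) ∂G := by
        refine integral_congr_ae ?_
        filter_upwards [hrev] with z hz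
        rw [hz, stressField_flipVel, stressField_flipVel]
    _ = ∫ w, (∫ y, χ₁ y.1 * (y.2 0 * y.2 1) ∂(empiricalMeasure (Ψ.flow (-t) (Ψ.flow t w)))) *
          (∫ y, χ₂ y.1 * (y.2 0 * y.2 1) ∂(empiricalMeasure (Ψ.flow t w))) ∂G :=
        (integral_comp_flow_localGibbsLaw_const σ 1 θ 0 N Ψ t hmeas).symm
    _ = ∫ w, (∫ y, χ₂ y.1 * (y.2 0 * y.2 1) ∂(empiricalMeasure (Ψ.flow t w))) *
          (∫ y, χ₁ y.1 * (y.2 0 * y.2 1) ∂(empiricalMeasure w)) ∂G := by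
        refine integral_congr_ae ?_
        filter_upwards [hgood] with w hw
        rw [Ψ.flow_neg_flow t hw, mul_comm]

end Summit.AtomisticToContinuum.HydrodynamicLimit.Theorems.MourreKoopmanChargesStressStrongMixing

end
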